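import Literature.IUT.HodgeArakelov.MonoThetaProjectiveProp16RefChainTF
import Literature.IUT.HodgeArakelov.MonoThetaProjectiveProp16EllipticRefIdentityWitness
import Literature.AnabelianGeometry.AbsoluteAnabelian.AbsTopII.EllipticCuspidalizationTFChainNonDegeneracy
import HarnessLib

/-!
# [IUTchII] Prop. 1.6 (ii): the chain successor predicate `RefIsEllipticChainTF` over the print-faithful record —
# bookkeeping, the load-bearing `N`, and NON-DEGENERACY (proof-only companion of `MonoThetaProjectiveProp16RefChainTF`)

PROOF-ONLY companion (no `def`, no new structure, no named fact, no instance) of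
`MonoThetaProjectiveProp16RefChainTF.lean` (p502687; abc-iut cell, seat abc-iut-w5-d033 gen 16, «L6 ROWS #6» piece (3b)(ii)
of abc-iut-L6-lead §F v1.19eh/ei/ej (A); DAG node **IUTchII:Prop1.6(ii)**, layer L6, outside the [IUTchIII] Cor. 3.12 cone;
finding T1g11-F1, MERGE-MAP §8S row B18).  It re-derives, over the v2-TF predicate and with the SAME proof terms,
abc-iut-L6-t2's `MonoThetaProjectiveProp16EllipticRefChainProofs.lean` (p450345) ×11 and the two identity-exclusion
theorems of `MonoThetaProjectiveProp16EllipticRefChainIdentityWitness.lean`; the non-degeneracy input over the TF record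
is this seat's `AbsTopII.EllipticCuspidalizationTF.RealizesChain.proj_not_injective_of_two_le`
(`AbsTopII/EllipticCuspidalizationTFChainNonDegeneracy.lean`, p448798 VERBATIM over abc-iut-L4-t4's record p496811 and
abc-iut-L4's chain-content predicate p502290).

S. Mochizuki, *Inter-universal Teichmüller Theory II*, kurims manuscript (Dec. 2020), §1, Prop. 1.6 (ii) p. 31
l. 34–41 ("… the surjection `Π_{U_N}(Π) ↠ Π` may be naturally identified with a certain surjection — i.e., “elliptic
cuspidalization” — that arises from a certain open immersion determined by the `N`-torsion points of a once-punctured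
elliptic curve … [so the augmentation `Π ↠ Π/Δ` determines, by composition, an augmentation `Π_{U_N}(Π) ↠ Π/Δ`]")
[claim: Mochizuki2012, status: disputed] (IUTchII §1 Prop 1.6 (ii), kurims p.31); [AbsTopII] Cor. 3.3 (iii)(a)(c)
pp. 68–69 [cite: MochizukiAbsTopII2013, Cor 3.3 (iii) p.68]; [SemiAnbd] §6 p. 69 (density of `Π^temp ↪ Π̂`), p. 73
(`DLoc`) [cite: MochizukiSemiAnbd2006, §6 pp.69-74].

WHAT IS PROVED (about the tree's own typed objects).
* (R0)/(R1) bookkeeping over v2-TF: `refHom_continuous`, `isClosed_ker`, `inertia_le_ker`, `removed_not_cusp_image`,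
  `range_aug_comp_refHom` (the composite augmentation has image EXACTLY `G_K`), `exists_aug_refHom_eq`, `transport`;
* the label `N` is load-bearing: `exists_level` (a PRINT-FAITHFUL record of level `N`), `exists_level_realizesChain`
  (… realizing the printed chain relative to the cusps of `X`; carried here from abc-iut-L6-t7's superseded p502634);
  `exists_isCusp_of_two_le` (`N ≥ 2` ⇒ `X` HAS A CUSP);
* NON-DEGENERACY survives the re-point: `not_of_completesToIso` (a reference surjection completing to an isomorphism
  `Π̂_U ⥲ Π̂_X` realizes no chain of level `N ≥ 2`), `not_of_refHom_eq_self`, `GenuineChainTF.refHom_ne_self`, and the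
  identity output of abc-iut-L6-t21 fails v2-TF: `IdentityWitness.not_refIsEllipticChainTF_idOutput`,
  `IdentityWitness.genuineChainTF_not_identity` — so the print-faithful re-point restores SATISFIABILITY of v1 (piece
  (4), abc-iut-L6-d7's `nonempty_ellipticCuspidalizationTF_of_isFreeProOn`, p501476) while the chain conjunct REMAINS the
  content gate.
HONEST SCOPE: statements about the tree's own typed objects; the v2-TF predicate is not inhabited here; nothing takes a
side on [IUTchIII] Cor. 3.12 or on any author; typed ≠ proved; nothing here asserts abc proved or refuted.
-/

noncomputable section

open Topology
open scoped Pointwise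

universe u


namespace Literature.IUT.HodgeArakelov

open Literature.AnabelianGeometry.SemiGraphs (TemperedCurve)
open Literature.AnabelianGeometry.AbsoluteAnabelian (FundamentalExtension)
open Literature.AnabelianGeometry.AbsoluteAnabelian.FundamentalExtension (CuspidalData)
open Literature.AlgebraicGeometry.Frobenioids (IsSlimGroup)

namespace EllipticCuspidalization

namespace RefIsEllipticChainTF

variable {S : ThetaSetting.{u}} {N : ℕ+} {P P' : TopGroup.{u}} {p : ℕ} [Fact p.Prime]
  {K : EllipticCuspidalization S N P} {X U : TemperedCurve p} {eX : X.PiTemp ≃ₜ* S.PiX}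
  {eU : U.PiTemp ≃ₜ* K.PiURef}

/-! ### The (R0)/(R1) bookkeeping, re-derived over the v2-TF predicate (same proof terms as p440541 / p450345) -/

/-- Under v2-TF the reference surjection `Π^tp_U ↠ Π^tp_X` is continuous. [cite: MochizukiSemiAnbd2006, §6 p.73] -/
theorem refHom_continuous (h : K.RefIsEllipticChainTF X U eX eU) : Continuous (K.refHom X U eX eU) :=
  eX.symm.continuous.comp (h.continuous_projRef.comp eU.continuous)

/-- Under v2-TF the kernel of `Π^tp_U ↠ Π^tp_X` is closed (`DLoc` shape). [cite: MochizukiSemiAnbd2006, §6 p.73] -/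
theorem isClosed_ker (h : K.RefIsEllipticChainTF X U eX eU) :
    IsClosed ((K.refHom X U eX eU).ker : Set U.PiTemp) := by
  obtain ⟨R, -, hker, -⟩ := h.kernel_eq
  rw [hker]
  exact Subgroup.isClosed_topologicalClosure _

/-- Under v2-TF the inertia groups of the removed cusps die in `Π^tp_X`. [cite: MochizukiSemiAnbd2006, §6 p.73] -/
theorem inertia_le_ker (h : K.RefIsEllipticChainTF X U eX eU) :
    ∃ R : Set U.Pt, (∀ x ∈ R, U.IsCusp x) ∧ ∀ x ∈ R, U.inertia x ≤ (K.refHom X U eX eU).ker := by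
  obtain ⟨R, hR, hker, -⟩ := h.kernel_eq
  refine ⟨R, hR, fun x hx g hg => ?_⟩
  rw [hker]
  refine Subgroup.le_topologicalClosure _ (Subgroup.subset_normalClosure ?_)
  exact Set.mem_biUnion hx hg

/-- Under v2-TF, [AbsTopII] Cor. 3.3 (iii)(c): the removed cusps lie over NON-cuspidal points of `X`.
[cite: MochizukiAbsTopII2013, Cor 3.3 (iii)(c) p.69] -/
theorem removed_not_cusp_image (h : K.RefIsEllipticChainTF X U eX eU) :
    ∃ R : Set U.Pt, (K.refHom X U eX eU).ker =
        (Subgroup.normalClosure (⋃ x ∈ R, (U.inertia x : Set U.PiTemp))).topologicalClosure ∧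
      ∀ x ∈ R, ∃ y : X.Pt, ¬ X.IsCusp y ∧ X.IsDecompositionGroup ((U.decomp x).map (K.refHom X U eX eU)) := by
  obtain ⟨R, -, hker, hc⟩ := h.kernel_eq
  refine ⟨R, hker, fun x hx => ?_⟩
  obtain ⟨y, hy, γ, hγ⟩ := hc x hx
  exact ⟨y, hy, y, γ, hγ⟩

/-- Under v2-TF the level `N` is load-bearing: a PRINT-FAITHFUL [AbsTopII] Cor. 3.3 (iii) record of level `N`.
[cite: MochizukiAbsTopII2013, Cor 3.3 (iii) p.68] -/
theorem exists_level (h : K.RefIsEllipticChainTF X U eX eU) :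
    ∃ (E : FundamentalExtension.{0})
      (C : Literature.AnabelianGeometry.AbsoluteAnabelian.AbsTopII.EllipticCuspidalizationTF E), C.N = (N : ℕ) := by
  obtain ⟨E, -, C, -, hN, -, -⟩ := h.elliptic
  exact ⟨E, C, hN⟩

/-- **The level `N` is load-bearing THROUGH THE CHAIN, print-faithful currency**: a TF record `C` with `C.N = N`
which REALIZES the printed chain of `N² − 1` de-cuspidalizations relative to cuspidal data that IS the cuspidal data
of `X` (`EllipticCuspidalizationTF.RealizesChain`). [cite: MochizukiAbsTopII2013, Cor 3.3 (iii)(a) p.68] -/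
theorem exists_level_realizesChain (h : K.RefIsEllipticChainTF X U eX eU) :
    ∃ (E : FundamentalExtension.{0}) (iX : X.PiHat ≃ₜ* E.arith)
      (C : Literature.AnabelianGeometry.AbsoluteAnabelian.AbsTopII.EllipticCuspidalizationTF E)
      (CD : CuspidalData E) (hP : IsSlimGroup E.arith) (hΔ : IsSlimGroup E.geom) (hne : E.geom ≠ ⊥),
      C.N = (N : ℕ) ∧ IsCuspidalDataOf X iX CD ∧ C.RealizesChain C.Sigma CD hP hΔ hne := by
  obtain ⟨E, iX, C, -, hN, -, -, CD, hP, hΔ, hne, hCD, hchain⟩ := h.ellipticChain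
  exact ⟨E, iX, C, CD, hP, hΔ, hne, hN, hCD, hchain⟩

/-- **The augmentation clause over v2-TF** ("so the augmentation `Π ↠ Π/Δ` determines, by composition, an
augmentation `Π_{U_N}(Π) ↠ Π/Δ`"): the image of `Π^tp_U ↠ Π^tp_X → G_{ℚ_p}` is EXACTLY `G_K` (abc-iut-w5-d030's
`range_aug_comp_refHom`, p440541, same term). [claim: Mochizuki2012, status: disputed] (IUTchII §1 Prop 1.6 (ii), kurims p.31) -/
theorem range_aug_comp_refHom (h : K.RefIsEllipticChainTF X U eX eU) :
    (X.aug.toMonoidHom.comp (K.refHom X U eX eU)).range = X.GK := by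
  have hU : U.aug.toMonoidHom.range = U.K.fixingSubgroup := U.range_aug
  ext g
  constructor
  · rintro ⟨y, rfl⟩
    have hy : U.aug y ∈ U.aug.toMonoidHom.range := ⟨y, rfl⟩
    rw [hU, h.K_eq] at hy
    simpa [TemperedCurve.GK, h.aug_comp y] using hy
  · intro hg
    have hg' : g ∈ U.aug.toMonoidHom.range := by
      rw [hU, h.K_eq]
      exact hg
    obtain ⟨y, hy⟩ := hg'
    exact ⟨y, by simpa [h.aug_comp y] using hy⟩

/-- Over v2-TF every element of `G_K` is the augmentation of some element coming from `Π^tp_U`.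
[claim: Mochizuki2012, status: disputed] (IUTchII §1 Prop 1.6 (ii), kurims p.31) -/
theorem exists_aug_refHom_eq (h : K.RefIsEllipticChainTF X U eX eU)
    {g : Literature.AnabelianGeometry.SemiGraphs.GQp p} (hg : g ∈ X.GK) :
    ∃ y : U.PiTemp, X.aug (K.refHom X U eX eU y) = g := by
  have : g ∈ (X.aug.toMonoidHom.comp (K.refHom X U eX eU)).range := by rw [h.range_aug_comp_refHom]; exact hg
  obtain ⟨y, hy⟩ := this
  exact ⟨y, hy⟩

/-- **Stability under the functorial transport** of the output along `P ≃ₜ* P'` (the reference side does not move).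
[claim: Mochizuki2012, status: disputed] (IUTchII §1 Prop 1.6 (ii), kurims p.31) -/
theorem transport (h : K.RefIsEllipticChainTF X U eX eU) (f : P ≃ₜ* P') :
    (K.transport f).RefIsEllipticChainTF X U eX eU where
  toRefIsEllipticTF :=
    { deltaTemp_eq := h.deltaTemp_eq
      K_eq := h.K_eq
      continuous_projRef := h.continuous_projRef
      aug_comp := h.aug_comp
      kernel_eq := h.kernel_eq
      elliptic := h.elliptic }
  ellipticChain := h.ellipticChain

/-! ### Non-degeneracy (the content gate survives the re-point) -/

/-- **The cusp tie is load-bearing over v2-TF**: with `N ≥ 2` the tempered curve `X` HAS A CUSP recorded by the chain's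
cuspidal data (first • step at a (3_Π) cuspidal decomposition group, tied to a cusp of `X` by `IsCuspidalDataOf`).
[cite: MochizukiAbsTopII2013, Cor 3.3 (iii)(a) p.68] -/
theorem exists_isCusp_of_two_le (h : K.RefIsEllipticChainTF X U eX eU) (hN : 2 ≤ (N : ℕ)) :
    ∃ x : X.Pt, X.IsCusp x := by
  obtain ⟨E, iX, C, -, hCN, -, -, CD, hP, hΔ, hne, hCD, hchain⟩ := h.ellipticChain
  obtain ⟨c, -, -, -, s, t, v, hst, htv, hvl, -, -, -, -, -, -, ψ, -, -, -, -, hsteps, -⟩ := hchain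
  have hNsq : 1 ≤ C.N ^ 2 - 1 := by
    have : 2 ^ 2 ≤ C.N ^ 2 := Nat.pow_le_pow_left (hCN ▸ hN) 2
    omega
  have hlt : s.val < t.val := by omega
  have hslen : s.val < c.len := by omega
  obtain ⟨φ, hde, -⟩ := hsteps ⟨s.val, hslen⟩ (le_refl _) hlt
  obtain ⟨-, -, D, hDmem, -⟩ := hde
  obtain ⟨cusp, -⟩ := hDmem
  obtain ⟨x, hx, -⟩ := hCD.1 cusp
  exact ⟨x, hx⟩

/-- **NON-DEGENERACY of the v2-TF predicate** (the re-point to the print-faithful record does NOT re-admit the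
identity shape).  If the tempered reference surjection `Π^tp_U ↠ Π^tp_X` COMPLETES TO AN ISOMORPHISM `f : Π̂_U ⥲ Π̂_X`
with `f ∘ toHat_U = toHat_X ∘ refHom`, then (R2′-TF) FAILS for every `N ≥ 2`: density of `Π^temp ↪ Π̂`
(`IsProfiniteCompletion.denseRange`) and the completion square force the TF record's output `Π_{U_X} ↠ Π'` to be
injective, against `EllipticCuspidalizationTF.RealizesChain.proj_not_injective_of_two_le`.
[cite: MochizukiAbsTopII2013, Cor 3.3 (iii)(a) p.68] -/
theorem not_of_completesToIso (hN : 2 ≤ (N : ℕ)) (f : U.PiHat ≃ₜ* X.PiHat)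
    (hf : ∀ y : U.PiTemp, f (U.toHat y) = X.toHat (K.refHom X U eX eU y)) :
    ¬ K.RefIsEllipticChainTF X U eX eU := by
  intro h
  obtain ⟨E, iX, C, iU, hCN, -, hsq, CD, hP, hΔ, hne, -, hchain⟩ := h.ellipticChain
  -- the completion square at the profinite level: `C.proj ∘ iU = iX ∘ f` on `Π̂_U`
  have hdense : DenseRange U.toHat := U.isProfiniteCompletion_toHat.denseRange
  have heq : (fun z : U.PiHat => C.proj.arith (iU z)) = fun z => iX (f z) := by
    refine Continuous.ext_on hdense ((map_continuous C.proj.arith).comp iU.continuous)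
      (iX.continuous.comp f.continuous) ?_
    rintro _ ⟨y, rfl⟩
    show C.proj.arith (iU (U.toHat y)) = iX (f (U.toHat y))
    rw [hf y]
    exact hsq y
  -- hence the output `Π_{U_X} ↠ Π'` of the record is injective …
  have hinj : Function.Injective C.proj.arith := by
    intro a b hab
    have ha := congrFun heq (iU.symm a)
    have hb := congrFun heq (iU.symm b)
    simp only [ContinuousMulEquiv.apply_symm_apply] at ha hb
    have hfab : iX (f (iU.symm a)) = iX (f (iU.symm b)) := by rw [← ha, ← hb, hab]
    exact iU.symm.injective (f.injective (iX.injective hfab))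
  -- … against the chain of level `N ≥ 2`
  have h2 : 2 ≤ C.N := hCN ▸ hN
  exact hchain.proj_not_injective_of_two_le h2 hinj

/-- **Corollary (the identity shape), v2-TF.** If `U = X` and the tempered reference surjection is the IDENTITY of
`Π^tp_X` (no cusp removed — the shape of the identity-TF witness of slice (b)), then (R2′-TF) fails for every
`N ≥ 2`: the print-faithful re-point restores SATISFIABILITY of v1, while the chain conjunct remains the CONTENT gate.
[claim: Mochizuki2012, status: disputed] (IUTchII §1 Prop 1.6 (ii), kurims p.31) -/
theorem not_of_refHom_eq_self {K : EllipticCuspidalization S N P} {X : TemperedCurve p} {eX : X.PiTemp ≃ₜ* S.PiX}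
    {eU : X.PiTemp ≃ₜ* K.PiURef} (hN : 2 ≤ (N : ℕ)) (hid : ∀ y : X.PiTemp, K.refHom X X eX eU y = y) :
    ¬ K.RefIsEllipticChainTF X X eX eU :=
  not_of_completesToIso hN (ContinuousMulEquiv.refl X.PiHat) fun y => by rw [hid y]; rfl

end RefIsEllipticChainTF

/-- **No v2-TF genuine output is the identity** at level `N ≥ 2` (structure form of `not_of_refHom_eq_self`).
[claim: Mochizuki2012, status: disputed] (IUTchII §1 Prop 1.6 (ii), kurims p.31) -/
theorem GenuineChainTF.refHom_ne_self {S : ThetaSetting.{u}} {N : ℕ+} {P : TopGroup.{u}} {p : ℕ} [Fact p.Prime]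
    {X : TemperedCurve p} {eX : X.PiTemp ≃ₜ* S.PiX} (hN : 2 ≤ (N : ℕ))
    (G : EllipticCuspidalization.GenuineChainTF S N P X X eX) :
    ¬ ∀ y : X.PiTemp, G.toEllipticCuspidalization.refHom X X eX G.eU y = y := fun hid =>
  RefIsEllipticChainTF.not_of_refHom_eq_self hN hid G.refIsEllipticChainTF

namespace IdentityWitness

variable (S : ThetaSetting.{0}) (N : ℕ+) {p : ℕ} [Fact p.Prime] (X : TemperedCurve p) (eX : X.PiTemp ≃ₜ* S.PiX)

/-- **abc-iut-L6-t21's identity output FAILS the v2-TF predicate** for every `N ≥ 2`, every tempered curve `X` and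
identification `eX` (its tempered reference surjection is the identity of `Π^tp_X`, `refHom_idOutput_apply`, which
completes to the identity of `Π̂_X`) — the TF twin of abc-iut-L6-t2's `not_refIsEllipticChain_idOutput` (p450345).
[claim: Mochizuki2012, status: disputed] (IUTchII §1 Prop 1.6 (ii), kurims p.31) -/
theorem not_refIsEllipticChainTF_idOutput (hN : 2 ≤ (N : ℕ)) :
    ¬ (idOutput S N).RefIsEllipticChainTF X X eX eX :=
  RefIsEllipticChainTF.not_of_completesToIso hN (ContinuousMulEquiv.refl X.PiHat) fun y => by
    rw [refHom_idOutput_apply]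
    rfl

/-- Hence, for `N ≥ 2`, NO v2-TF genuine output `GenuineChainTF S N S.PiX X X eX` has BOTH the identity as underlying
output AND `eX` as its reference identification (TF twin of `genuineChain_not_identity`, p450345).
[claim: Mochizuki2012, status: disputed] (IUTchII §1 Prop 1.6 (ii), kurims p.31) -/
theorem genuineChainTF_not_identity (hN : 2 ≤ (N : ℕ)) (G : EllipticCuspidalization.GenuineChainTF S N S.PiX X X eX)
    (hG : G.toEllipticCuspidalization = idOutput S N) : ¬ HEq G.eU eX := by
  intro heU
  cases G with
  | mk toGenuineTF hchain =>
    cases toGenuineTF with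
    | mk K eU h₀ =>
      change K = idOutput S N at hG
      subst hG
      change HEq eU eX at heU
      have heU' : eU = eX := eq_of_heq heU
      subst heU'
      exact not_refIsEllipticChainTF_idOutput S N X eU hN hchain

end IdentityWitness

end EllipticCuspidalization

end Literature.IUT.HodgeArakelov

end
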